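/-
Copyright (c) 2026 the pub-hodgecm-mathlib formalisation cell (harness21).  Prover seat hodgecm-mathlib-K2E4-p18 (g2), Track B «K2-LIT» ∕ h413
(stmt-HodgeConjecture-24833), deal K2E4-plan (g0) 22:31:39Z: socket #22N `sig_K2E4WeakMatrixFiniteTransportNonsplit` — its reduction to the central-value
rigidity socket (RIG_v^ns) `sig_K2E4CentralValueRigidityNonsplit` (REPORT-22 §4).  2026-09-03.
-/
import Literature.NumberTheory.Rogawski1990.FinExplicitTransferFactorConjLeft     -- ★ `finExplicitDelta_conj_left_all`  (explicit collection `Δ‴`)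
import Literature.NumberTheory.Rogawski1990.FinExplicitTransferFactorConjRight    -- ★ `finExplicitDelta_conj_right_all`
import Literature.NumberTheory.Rogawski1990.LocalTransferExistence               -- ★ `IsLocalDeltaTransferExists`
import Literature.NumberTheory.Rogawski1990.LocalTransferFundamentalLemma        -- ★ `IsLocSmooth`
import HarnessLib

/-!
# K2 · E4 helper — socket #22 (any place) from CENTRAL-VALUE RIGIDITY: the transport is pure logic once `f^H(z_v) = ψ₀ · f^{H‴}(z_v)`

Cell `pub/hodgecm-mathlib`, Track B «K2-LIT», seat `hodgecm-mathlib-K2E4-p18` (g2); crux H413 = `stmt-HodgeConjecture-24833` (supports-only helper).  THEOREMS ONLY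
(no definition, no instance, no notation, no named fact, no `sorry`).  Companion of ★ `K2E4WeakMatrixFiniteTransportOfGermRigidity` (p855314: at SPLIT places the
rigidity is DERIVED from germ structure); here the rigidity is the HYPOTHESIS — the shape of the cand socket (RIG_v^ns) `sig_K2E4CentralValueRigidityNonsplit`
(`K2/K2E4-p18/g2/sig_K2E4Socket22Inputs.cand.K2E4-p18-g2.lean` :126; XL, NOT IN PRINT, the honest residue of #22N per REPORT-22 §4 and K2E4-plan (g0) 22:31:39Z) — and
the file records that NOTHING ELSE is needed: **#22N at `v` ⟸ (RIG_v) + existence of smooth `Δ‴_v`-transfers** ([Rogawski1990, Prop. 4.9.1 (a)], a named fact of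
the tree at non-split `v`).  (κ-loc)_v[Δ‴_v, c₁] gives `Φ^st((γ₀)_v, f) = c₁ f^{H‴}(z_v) = (c₁ψ₀⁻¹) f^H(z_v)` for every weak pair `(f^H, f)`, choosing any explicit
transfer `f^{H‴}` of the same `f`.

* §1 (abstract, any groups) **`kappaTransport_of_centralValueRigidity`**.
* §2 (finite `v`, `cmDatum` carriers) **`weakMatrixFiniteTransport_of_centralValueRigidity`** — socket #22's per-place implication (functional
  `localStableOrbitalIntegral L 3 H′ v mGs₀v f (γ₀)_v`, point `(γ_H)_v`, reference factor `finExplicitCollection L H′ μ … v`) VERBATIM, from (RIG_v) with its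
  binders token for token as in the cand socket, and `IsLocalDeltaTransferExists` for `Δ‴_v`.

HONEST LABEL: HC_CM is proved only modulo the 7 printed citations (2 remaining named inputs: hLiu418 = stmt-HodgeConjecture-24832, h413 = stmt-HodgeConjecture-24833)
until rung 0 closes; this file proves no printed analytic statement and does NOT pay #22N (it pays it modulo (RIG_v^ns) and Prop. 4.9.1 (a)).

## References
* [Rogawski1990] J. D. Rogawski, *Automorphic Representations of Unitary Groups in Three Variables* (1990): §4.3 (4.3.1) p. 43; §4.9 Prop. 4.9.1 (a) p. 55;
  §8.2 Prop. 8.2.1 (a) p. 117, proof pp. 118–119; §8.1 Prop. 8.1.3 pp. 115–116.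
* [LanglandsShelstad1987] R. P. Langlands, D. Shelstad, On the definition of transfer factors, Math. Ann. 278 (1987), §4.2.
-/

set_option autoImplicit false
set_option linter.dupNamespace false

noncomputable section

open MeasureTheory Measure NumberField IsDedekindDomain
open Literature.NumberTheory.Rogawski1990 Literature.NumberTheory.Automorphic Literature.NumberTheory.GaloisRepresentations
open scoped Matrix MatrixGroups

namespace Summit.HodgeConjecture.HodgeConjecture.Cruxes.H413.K2E4WeakMatrixFiniteTransportOfRigidity

/-! ## §1 Abstract -/

section Abstract

variable {A B : Type*} [Group A] [Group B]
  [∀ a : A, MeasurableSpace (A ⧸ Subgroup.centralizer ({a} : Set A))]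
  [∀ b : B, MeasurableSpace (B ⧸ Subgroup.centralizer ({b} : Set B))]

/-- **κ-TRANSPORT FROM CENTRAL-VALUE RIGIDITY** (abstract): if `f^H(z) = ψ₀·f^{H′}(z)` (`ψ₀ ≠ 0`) for every `T`-pair and `T′`-pair of the same smooth `f`, and
`T′`-transfers of smooth functions exist, then «`F f = κ₁ · f^{H′}(z)` for every `T′`-pair» (`κ₁ ≠ 0`) implies «`F f = (κ₁ψ₀⁻¹) · f^H(z)` for every `T`-pair», for
ANY functional `F`. [cite: Rogawski1990, §8.2 Prop. 8.2.1 (a) p. 117; §4.9 Prop. 4.9.1 (a) p. 55] -/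
theorem kappaTransport_of_centralValueRigidity
    {R : A → B → Prop} {stA : A → A → Prop} {regA : A → Prop} {T T' : TransferFactorData A B R}
    {mH : OrbitalMeasureFamily A} {mG : OrbitalMeasureFamily B} (SmoothG : (B → ℂ) → Prop) (SmoothH : (A → ℂ) → Prop) (z : A)
    (hrig : ∃ ψ₀ : ℂ, ψ₀ ≠ 0 ∧ ∀ (f : B → ℂ) (fH fH' : A → ℂ), SmoothG f → SmoothH fH → SmoothH fH' →
      IsDeltaTransferRel R stA regA T mH mG fH f → IsDeltaTransferRel R stA regA T' mH mG fH' f → fH z = ψ₀ * fH' z)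
    (hT' : ∀ f : B → ℂ, SmoothG f → ∃ fH' : A → ℂ, SmoothH fH' ∧ IsDeltaTransferRel R stA regA T' mH mG fH' f)
    (F : (B → ℂ) → ℂ) {κ₁ : ℂ} (hκ₁ : κ₁ ≠ 0)
    (h : ∀ (fH' : A → ℂ) (f : B → ℂ), SmoothG f → SmoothH fH' → IsDeltaTransferRel R stA regA T' mH mG fH' f → F f = κ₁ * fH' z) :
    ∃ κ : ℂ, κ ≠ 0 ∧
      ∀ (fH : A → ℂ) (f : B → ℂ), SmoothG f → SmoothH fH → IsDeltaTransferRel R stA regA T mH mG fH f → F f = κ * fH z := by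
  obtain ⟨ψ₀, hψ₀, hrig⟩ := hrig
  refine ⟨κ₁ * ψ₀⁻¹, mul_ne_zero hκ₁ (inv_ne_zero hψ₀), fun fH f hf hfH hrel => ?_⟩
  obtain ⟨fH', hfH', hrel'⟩ := hT' f hf
  rw [h fH' f hf hfH' hrel', hrig f fH fH' hf hfH hfH' hrel hrel', mul_assoc, inv_mul_cancel_left₀ hψ₀]

end Abstract

/-! ## §2 The finite-place dress: socket #22 at `v` from (RIG_v) -/

section Fin

variable (L : Type) [Field L] [NumberField L] [IsCMField L] (H' : Matrix (Fin 3) (Fin 3) L) (v : HeightOneSpectrum (𝓞 ↥(maximalRealSubfield L)))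

/-- **SOCKET #22 AT A PLACE FROM CENTRAL-VALUE RIGIDITY** — `sig_K2E4WeakMatrixFiniteTransport{,Split,Nonsplit}`'s per-place implication with its functional
(`Φ^st((γ₀)_v, f)` of `mGs₀ v`), point `(γ_H)_v` and reference factor `Δ‴_v(μ) = finExplicitCollection L H′ μ … v` VERBATIM (families read at the fixed `v`), from
(RIG_v) «`∃ ψ₀ ≠ 0`, `f^H((γ_H)_v) = ψ₀ · f^{H‴}((γ_H)_v)` for every smooth `Δv`-pair `(f^H, f)` and smooth `Δ‴_v`-pair `(f^{H‴}, f)`» — the conclusion of the cand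
socket `sig_K2E4CentralValueRigidityNonsplit` token for token — and EXISTENCE of smooth `Δ‴_v`-transfers (Prop. 4.9.1 (a)).  Valid at every place; at split places
★ `K2E4WeakMatrixFiniteTransportOfGermRigidity` derives (RIG_v) from germ structure instead.
[cite: Rogawski1990, §8.2 Prop. 8.2.1 (a) p. 117; §4.9 Prop. 4.9.1 (a) p. 55] -/
theorem weakMatrixFiniteTransport_of_centralValueRigidity
    {_ha : ∀ a : ((UnitaryGroup.cmDatum L 2 (Matrix.of fun i j : Fin 2 => if i.val + j.val + 1 = 2 then (1 : L) else 0)).Local v ×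
        (UnitaryGroup.cmDatum L 1 (Matrix.of fun i j : Fin 1 => if i.val + j.val + 1 = 1 then (1 : L) else 0)).Local v),
      MeasurableSpace (((UnitaryGroup.cmDatum L 2 (Matrix.of fun i j : Fin 2 => if i.val + j.val + 1 = 2 then (1 : L) else 0)).Local v × (UnitaryGroup.cmDatum L 1 (Matrix.of fun i j : Fin 1 => if i.val + j.val + 1 = 1 then (1 : L) else 0)).Local v) ⧸
        Subgroup.centralizer ({a} : Set ((UnitaryGroup.cmDatum L 2 (Matrix.of fun i j : Fin 2 => if i.val + j.val + 1 = 2 then (1 : L) else 0)).Local v × (UnitaryGroup.cmDatum L 1 (Matrix.of fun i j : Fin 1 => if i.val + j.val + 1 = 1 then (1 : L) else 0)).Local v)))}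
    {_hγ : ∀ γ : (UnitaryGroup.cmDatum L 3 H').Local v,
      MeasurableSpace ((UnitaryGroup.cmDatum L 3 H').Local v ⧸ Subgroup.centralizer ({γ} : Set ((UnitaryGroup.cmDatum L 3 H').Local v)))}
    (Δv : LocalTransferFactor L H' v) (μ : HeckeCharacter L)
    (mHv : OrbitalMeasureFamily ((UnitaryGroup.cmDatum L 2 (Matrix.of fun i j : Fin 2 => if i.val + j.val + 1 = 2 then (1 : L) else 0)).Local v ×
        (UnitaryGroup.cmDatum L 1 (Matrix.of fun i j : Fin 1 => if i.val + j.val + 1 = 1 then (1 : L) else 0)).Local v))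
    (mGv mGs₀v : OrbitalMeasureFamily ((UnitaryGroup.cmDatum L 3 H').Local v))
    (γ₀ : (UnitaryGroup.cmDatum L 3 H').Rational)
    (γH : (UnitaryGroup.cmDatum L 2 (Matrix.of fun i j : Fin 2 => if i.val + j.val + 1 = 2 then (1 : L) else 0)).Rational ×
      (UnitaryGroup.cmDatum L 1 (Matrix.of fun i j : Fin 1 => if i.val + j.val + 1 = 1 then (1 : L) else 0)).Rational)
    (hrig : ∃ ψ₀ : ℂ, ψ₀ ≠ 0 ∧
      ∀ (f : (UnitaryGroup.cmDatum L 3 H').Local v → ℂ)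
        (fH fH3 : ((UnitaryGroup.cmDatum L 2 (Matrix.of fun i j : Fin 2 => if i.val + j.val + 1 = 2 then (1 : L) else 0)).Local v ×
        (UnitaryGroup.cmDatum L 1 (Matrix.of fun i j : Fin 1 => if i.val + j.val + 1 = 1 then (1 : L) else 0)).Local v) → ℂ),
        IsLocSmooth f → IsLocSmooth fH → IsLocSmooth fH3 →
        IsLocalDeltaTransfer L H' v Δv mHv mGv fH f →
        IsLocalDeltaTransfer L H' v (finExplicitCollection L H' μ (finExplicitDelta_conj_left_all L H' μ) (finExplicitDelta_conj_right_all L H' μ) v) mHv mGv fH3 f →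
        fH ((UnitaryGroup.cmDatum L 2 (Matrix.of fun i j : Fin 2 => if i.val + j.val + 1 = 2 then (1 : L) else 0)).toLocal v ((UnitaryGroup.cmDatum L 2 (Matrix.of fun i j : Fin 2 => if i.val + j.val + 1 = 2 then (1 : L) else 0)).toAdelic γH.1),
            (UnitaryGroup.cmDatum L 1 (Matrix.of fun i j : Fin 1 => if i.val + j.val + 1 = 1 then (1 : L) else 0)).toLocal v ((UnitaryGroup.cmDatum L 1 (Matrix.of fun i j : Fin 1 => if i.val + j.val + 1 = 1 then (1 : L) else 0)).toAdelic γH.2)) =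
          ψ₀ * fH3 ((UnitaryGroup.cmDatum L 2 (Matrix.of fun i j : Fin 2 => if i.val + j.val + 1 = 2 then (1 : L) else 0)).toLocal v ((UnitaryGroup.cmDatum L 2 (Matrix.of fun i j : Fin 2 => if i.val + j.val + 1 = 2 then (1 : L) else 0)).toAdelic γH.1),
            (UnitaryGroup.cmDatum L 1 (Matrix.of fun i j : Fin 1 => if i.val + j.val + 1 = 1 then (1 : L) else 0)).toLocal v ((UnitaryGroup.cmDatum L 1 (Matrix.of fun i j : Fin 1 => if i.val + j.val + 1 = 1 then (1 : L) else 0)).toAdelic γH.2)))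
    (hTexp : IsLocalDeltaTransferExists L H' v (finExplicitCollection L H' μ (finExplicitDelta_conj_left_all L H' μ) (finExplicitDelta_conj_right_all L H' μ) v) mHv mGv IsLocSmooth IsLocSmooth) :
    (∃ cv : ℂ, cv ≠ 0 ∧ ∀
          (fH : ((UnitaryGroup.cmDatum L 2 (Matrix.of fun i j : Fin 2 => if i.val + j.val + 1 = 2 then (1 : L) else 0)).Local v ×
        (UnitaryGroup.cmDatum L 1 (Matrix.of fun i j : Fin 1 => if i.val + j.val + 1 = 1 then (1 : L) else 0)).Local v) → ℂ) (f : (UnitaryGroup.cmDatum L 3 H').Local v → ℂ),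
        IsLocSmooth f → IsLocSmooth fH → IsLocalDeltaTransfer L H' v (finExplicitCollection L H' μ (finExplicitDelta_conj_left_all L H' μ) (finExplicitDelta_conj_right_all L H' μ) v) mHv mGv fH f →
        localStableOrbitalIntegral L 3 H' v mGs₀v f ((UnitaryGroup.cmDatum L 3 H').toLocal v ((UnitaryGroup.cmDatum L 3 H').toAdelic γ₀)) =
          cv * fH ((UnitaryGroup.cmDatum L 2 (Matrix.of fun i j : Fin 2 => if i.val + j.val + 1 = 2 then (1 : L) else 0)).toLocal v ((UnitaryGroup.cmDatum L 2 (Matrix.of fun i j : Fin 2 => if i.val + j.val + 1 = 2 then (1 : L) else 0)).toAdelic γH.1),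
            (UnitaryGroup.cmDatum L 1 (Matrix.of fun i j : Fin 1 => if i.val + j.val + 1 = 1 then (1 : L) else 0)).toLocal v ((UnitaryGroup.cmDatum L 1 (Matrix.of fun i j : Fin 1 => if i.val + j.val + 1 = 1 then (1 : L) else 0)).toAdelic γH.2))) →
    ∃ cv : ℂ, cv ≠ 0 ∧ ∀
          (fH : ((UnitaryGroup.cmDatum L 2 (Matrix.of fun i j : Fin 2 => if i.val + j.val + 1 = 2 then (1 : L) else 0)).Local v ×
        (UnitaryGroup.cmDatum L 1 (Matrix.of fun i j : Fin 1 => if i.val + j.val + 1 = 1 then (1 : L) else 0)).Local v) → ℂ) (f : (UnitaryGroup.cmDatum L 3 H').Local v → ℂ),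
        IsLocSmooth f → IsLocSmooth fH → IsLocalDeltaTransfer L H' v Δv mHv mGv fH f →
        localStableOrbitalIntegral L 3 H' v mGs₀v f ((UnitaryGroup.cmDatum L 3 H').toLocal v ((UnitaryGroup.cmDatum L 3 H').toAdelic γ₀)) =
          cv * fH ((UnitaryGroup.cmDatum L 2 (Matrix.of fun i j : Fin 2 => if i.val + j.val + 1 = 2 then (1 : L) else 0)).toLocal v ((UnitaryGroup.cmDatum L 2 (Matrix.of fun i j : Fin 2 => if i.val + j.val + 1 = 2 then (1 : L) else 0)).toAdelic γH.1),
            (UnitaryGroup.cmDatum L 1 (Matrix.of fun i j : Fin 1 => if i.val + j.val + 1 = 1 then (1 : L) else 0)).toLocal v ((UnitaryGroup.cmDatum L 1 (Matrix.of fun i j : Fin 1 => if i.val + j.val + 1 = 1 then (1 : L) else 0)).toAdelic γH.2)) := by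
  rintro ⟨cv₁, h₁, h⟩
  exact kappaTransport_of_centralValueRigidity IsLocSmooth IsLocSmooth _ hrig hTexp
    (fun f => localStableOrbitalIntegral L 3 H' v mGs₀v f ((UnitaryGroup.cmDatum L 3 H').toLocal v ((UnitaryGroup.cmDatum L 3 H').toAdelic γ₀))) h₁ h

end Fin

end Summit.HodgeConjecture.HodgeConjecture.Cruxes.H413.K2E4WeakMatrixFiniteTransportOfRigidity

end
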